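import Literature.NumberTheory.Transcendental.RankOneGridTrdeg
import Literature.NumberTheory.Transcendental.RoyCriterion
import HarnessLib

/-!
# Rank-one grids `xᵢyⱼ`: the inequality (★) and the `t`-clause of Conjecture 2.3 from Schanuel

Continuation of `RankOneGridTrdeg.lean` (notation as there: `P = {xᵢyⱼ}`, `r = dim_ℚ span_ℚ P`,
`a = trdeg_ℚ ℚ(P)`, columns `Cⱼ`). Statements and proofs are ours ([folklore], fully proved).

## Content

* **Filtration** (`colInvariant_insert`, `colInvariant_pair`, `colInvariant_univ`): the invariant
  `trdeg ℚ(columns J) + (d - 1) ≤ dim span(columns J)` holds for `J = {j₀, j}` when `yⱼ/y_{j₀}` is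
  transcendental (Lemma A with the multiplier `ρ = yⱼ/y_{j₀}` carrying `C_{j₀}` onto `Cⱼ`, or
  disjointness of the two column spans), and is preserved when a column is added (either the field
  does not change, or the dimension jumps by `d` while `trdeg` rises by `≤ 1`).
* **Column / row theorems** (`trdeg_add_le_finrank_of_transcendental_col/_row`): some
  `yⱼ/y_{j₀}` transcendental ⟹ `a + (d - 1) ≤ r`; some `xᵢ/x_{i₀}` transcendental ⟹
  `a + (ℓ - 1) ≤ r` (transpose).
* **Algebraic case** (`trdeg_adjoin_grid_le_one_of_isAlgebraic`): all ratios algebraic ⟹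
  `ℚ(P) ⊆ ℚ(x_{i₀}y_{j₀}, ratios)`, so `a ≤ 1`.
* **(★)** `trdeg_add_min_sub_one_le_finrank_grid`: `a + (min(d, ℓ) - 1) ≤ r`. Sharp: `x` a
  `ℚ`-basis of `θF` and `y` a `ℚ`-basis of `F` for a number field `F` of degree `n = d = ℓ` and
  `θ` transcendental give `r = n`, `a = 1`.
* **Schanuel step** (`finrank_span_grid_le_trdeg_exp_add`): under Schanuel's conjecture,
  `r ≤ trdeg ℚ(e^{xᵢyⱼ}) + a` (a `ℚ`-basis `B ⊆ P` of the span is `ℚ`-linearly independent, so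
  `|B| ≤ trdeg ℚ(B, e^B) ≤ trdeg ℚ(e^P ∪ B) ≤ trdeg ℚ(e^P) + trdeg ℚ(B)`).
* **`min_sub_one_le_trdeg_exp_grid_of_schanuel`**: Schanuel ⟹ `trdeg ℚ(e^{xᵢyⱼ}) ≥ min(d, ℓ) - 1`
  for `ℚ`-linearly independent `x`, `y` — hence (as `[dℓ/(ℓ+d)] ≤ min(d,ℓ) - 1`) the `t`-clause of
  Waldschmidt's Conjecture 2.3, assembled with the `t₁`- and `t₂`-clauses in
  `Literature/Barriers/Schanuel/LargeTranscendenceDegreeConjectureProofs.lean`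
  (`waldschmidtConjecture_2_3_of_schanuel`).

## References

* [NesterenkoPhilippon2001] Yu. V. Nesterenko, P. Philippon (eds.), *Introduction to Algebraic
  Independence Theory*, LNM 1752 (2001), Ch. 14 (M. Waldschmidt), Conjecture 2.3, p. 214.
* [Roy2001] D. Roy, *An arithmetic criterion for the values of the exponential function*,
  Acta Arith. 97 (2001), Conjecture 1 (`SchanuelRank`).
-/

noncomputable section

open Complex IntermediateField Cardinal
open Literature.Barriers.Schanuel (trdeg_mono trdeg_adjoin_union_eq_of_isAlgebraic)

namespace Literature.NumberTheory.Transcendental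

section Grid

variable {d l : ℕ} {x : Fin d → ℂ} {y : Fin l → ℂ}

/-- **Filtration step.** The invariant `trdeg ℚ(columns J) + (d - 1) ≤ dim span(columns J)` is
preserved when a column is added (if the new column's span meets the old span only in `0` the
dimension jumps by `d` while `trdeg` rises by at most `1`; otherwise the field does not change).
[folklore] -/
theorem colInvariant_insert {J : Finset (Fin l)} (i₀ : Fin d) {j₀ : Fin l}
    (hx : LinearIndependent ℚ x) (hy : ∀ j, y j ≠ 0) (hj₀ : j₀ ∈ J) (k : Fin l)
    (hJ : Algebra.trdeg ℚ ↥(adjoin ℚ (gridCols x y J)) + ((d - 1 : ℕ) : Cardinal) ≤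
      (Module.finrank ℚ (Submodule.span ℚ (gridCols x y J)) : Cardinal)) :
    Algebra.trdeg ℚ ↥(adjoin ℚ (gridCols x y (insert k J))) + ((d - 1 : ℕ) : Cardinal) ≤
      (Module.finrank ℚ (Submodule.span ℚ (gridCols x y (insert k J))) : Cardinal) := by
  have hx₀ : x i₀ ≠ 0 := hx.ne_zero i₀
  have hd : 1 ≤ d := i₀.pos
  haveI : FiniteDimensional ℚ (Submodule.span ℚ (gridCols x y J)) :=
    FiniteDimensional.span_of_finite ℚ (finite_gridCols x y J)
  haveI : FiniteDimensional ℚ (Submodule.span ℚ (gridCols x y (insert k J))) :=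
    FiniteDimensional.span_of_finite ℚ (finite_gridCols x y _)
  haveI : FiniteDimensional ℚ (Submodule.span ℚ (Set.range (gridCol x y k))) :=
    FiniteDimensional.span_of_finite ℚ (Set.finite_range _)
  have hspan : Submodule.span ℚ (gridCols x y (insert k J)) =
      Submodule.span ℚ (Set.range (gridCol x y k)) ⊔ Submodule.span ℚ (gridCols x y J) := by
    rw [gridCols_insert, Submodule.span_union]
  by_cases hbot :
      Submodule.span ℚ (Set.range (gridCol x y k)) ⊓ Submodule.span ℚ (gridCols x y J) = ⊥
  · have hr : Module.finrank ℚ (Submodule.span ℚ (gridCols x y (insert k J))) =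
        d + Module.finrank ℚ (Submodule.span ℚ (gridCols x y J)) := by
      have h := Submodule.finrank_sup_add_finrank_inf_eq
        (Submodule.span ℚ (Set.range (gridCol x y k))) (Submodule.span ℚ (gridCols x y J))
      rw [hbot, finrank_bot, add_zero, finrank_span_gridCol hx (hy k), ← hspan] at h
      exact h
    have ht := trdeg_adjoin_gridCols_insert_le (x := x) (y := y) hj₀ hx₀ (hy j₀) k
    rw [hr]
    calc Algebra.trdeg ℚ ↥(adjoin ℚ (gridCols x y (insert k J))) + ((d - 1 : ℕ) : Cardinal)
        ≤ (Algebra.trdeg ℚ ↥(adjoin ℚ (gridCols x y J)) + 1) + ((d - 1 : ℕ) : Cardinal) := by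
          gcongr
      _ = (Algebra.trdeg ℚ ↥(adjoin ℚ (gridCols x y J)) + ((d - 1 : ℕ) : Cardinal)) + 1 :=
          add_right_comm _ _ _
      _ ≤ (Module.finrank ℚ (Submodule.span ℚ (gridCols x y J)) : Cardinal) + 1 := by gcongr
      _ ≤ ((d + Module.finrank ℚ (Submodule.span ℚ (gridCols x y J)) : ℕ) : Cardinal) := by
          exact_mod_cast (by omega)
  · have heq := adjoin_gridCols_insert_eq_of_inf_ne_bot hj₀ hx₀ (hy j₀) hbot
    rw [heq]
    refine hJ.trans ?_
    exact_mod_cast Submodule.finrank_mono (hspan ▸ le_sup_right)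

/-- **Filtration base.** For two columns `j₀, j` with `yⱼ/y_{j₀}` transcendental over `ℚ`:
`trdeg ℚ(columns {j₀, j}) + (d - 1) ≤ dim span(columns {j₀, j})`. If the two column spans meet
only in `0` the dimension is `2d` and `trdeg ≤ d + 1`; otherwise the field is `ℚ(column j₀)` and
Lemma A (`trdeg_add_finrank_stab_le`, multiplier `ρ = yⱼ/y_{j₀}` carrying column `j₀` onto column
`j`) bounds `trdeg ℚ(column j₀) + dim(overlap) ≤ d + 1`. [folklore] -/
theorem colInvariant_pair (i₀ : Fin d) {j₀ j : Fin l} (hx : LinearIndependent ℚ x)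
    (hy : ∀ j, y j ≠ 0) (hρ : Transcendental ℚ (y j / y j₀)) :
    Algebra.trdeg ℚ ↥(adjoin ℚ (gridCols x y (insert j {j₀}))) + ((d - 1 : ℕ) : Cardinal) ≤
      (Module.finrank ℚ (Submodule.span ℚ (gridCols x y (insert j {j₀}))) : Cardinal) := by
  have hx₀ : x i₀ ≠ 0 := hx.ne_zero i₀
  have hd : 1 ≤ d := i₀.pos
  have hj₀ : j₀ ∈ ({j₀} : Finset (Fin l)) := Finset.mem_singleton_self _
  have hA := trdeg_add_finrank_stab_le (gridCol x y j₀) hρ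
  set ρ : ℂ := y j / y j₀ with hρdef
  have hρ0 : ρ ≠ 0 := div_ne_zero (hy j) (hy j₀)
  set V0 : Submodule ℚ ℂ := Submodule.span ℚ (Set.range (gridCol x y j₀)) with hV0
  set Vj : Submodule ℚ ℂ := Submodule.span ℚ (Set.range (gridCol x y j)) with hVj
  set W : Submodule ℚ ℂ := V0 ⊓ V0.comap (LinearMap.mulLeft ℚ ρ) with hW
  haveI : FiniteDimensional ℚ V0 := FiniteDimensional.span_of_finite ℚ (Set.finite_range _)
  haveI : FiniteDimensional ℚ Vj := FiniteDimensional.span_of_finite ℚ (Set.finite_range _)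
  haveI : FiniteDimensional ℚ W := Submodule.finiteDimensional_of_le inf_le_left
  haveI : FiniteDimensional ℚ ↥(Vj ⊓ V0) := Submodule.finiteDimensional_of_le inf_le_right
  haveI : FiniteDimensional ℚ (Submodule.span ℚ (gridCols x y (insert j {j₀}))) :=
    FiniteDimensional.span_of_finite ℚ (finite_gridCols x y _)
  have hspan : Submodule.span ℚ (gridCols x y (insert j {j₀})) = Vj ⊔ V0 := by
    rw [gridCols_insert, gridCols_singleton, Submodule.span_union]
  have hE0 : adjoin ℚ (gridCols x y {j₀}) = adjoin ℚ (Set.range (gridCol x y j₀)) := by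
    rw [gridCols_singleton]
  have hfin := Submodule.finrank_sup_add_finrank_inf_eq Vj V0
  rw [finrank_span_gridCol hx (hy j), finrank_span_gridCol hx (hy j₀)] at hfin
  have ht0 : Algebra.trdeg ℚ ↥(adjoin ℚ (Set.range (gridCol x y j₀))) ≤ (d : Cardinal) := by
    refine (trdeg_adjoin_le_mk _).trans ?_
    simpa using Cardinal.mk_range_le (f := gridCol x y j₀)
  have ht := trdeg_adjoin_gridCols_insert_le (x := x) (y := y) hj₀ hx₀ (hy j₀) j
  rw [hE0] at ht
  by_cases hbot : Vj ⊓ V0 = ⊥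
  · have hr : Module.finrank ℚ (Submodule.span ℚ (gridCols x y (insert j {j₀}))) = d + d := by
      rw [hspan]
      rw [hbot, finrank_bot, add_zero] at hfin
      exact hfin
    rw [hr]
    calc Algebra.trdeg ℚ ↥(adjoin ℚ (gridCols x y (insert j {j₀}))) + ((d - 1 : ℕ) : Cardinal)
        ≤ (Algebra.trdeg ℚ ↥(adjoin ℚ (Set.range (gridCol x y j₀))) + 1) +
            ((d - 1 : ℕ) : Cardinal) := by gcongr
      _ ≤ ((d : Cardinal) + 1) + ((d - 1 : ℕ) : Cardinal) := by gcongr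
      _ = ((d + 1 + (d - 1) : ℕ) : Cardinal) := by push_cast; rfl
      _ = ((d + d : ℕ) : Cardinal) := by congr 1; omega
  · -- the two column spans overlap: the field is `ℚ(column j₀)`, and Lemma A applies
    have heq := adjoin_gridCols_insert_eq_of_inf_ne_bot hj₀ hx₀ (hy j₀) (k := j)
      (by rwa [gridCols_singleton])
    rw [heq, hE0]
    have hVj_map : Vj = V0.map (LinearMap.mulLeft ℚ ρ) := by
      rw [hVj, hV0, Submodule.map_span, ← Set.range_comp]
      congr 2
      funext i
      have hy₀ := hy j₀
      simp only [Function.comp_apply, LinearMap.mulLeft_apply, gridCol_apply, hρdef]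
      field_simp
    have hcW : Module.finrank ℚ ↥(Vj ⊓ V0) ≤ Module.finrank ℚ W := by
      have hmemW : ∀ v : ↥(Vj ⊓ V0), ρ⁻¹ * (v : ℂ) ∈ W := by
        intro v
        obtain ⟨hv1, hv2⟩ := Submodule.mem_inf.mp v.2
        have hv1' : (v : ℂ) ∈ V0.map (LinearMap.mulLeft ℚ ρ) := by
          rw [← hVj_map]
          exact hv1
        obtain ⟨v0, hv0, hv0eq⟩ := Submodule.mem_map.mp hv1'
        have hv0' : ρ⁻¹ * (v : ℂ) = v0 := by
          rw [← hv0eq, LinearMap.mulLeft_apply, inv_mul_cancel_left₀ hρ0]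
        refine Submodule.mem_inf.mpr ⟨hv0' ▸ hv0, ?_⟩
        rw [Submodule.mem_comap, LinearMap.mulLeft_apply, mul_inv_cancel_left₀ hρ0]
        exact hv2
      let g : ↥(Vj ⊓ V0) →ₗ[ℚ] W :=
        LinearMap.codRestrict W ((LinearMap.mulLeft ℚ ρ⁻¹) ∘ₗ (Vj ⊓ V0).subtype) hmemW
      refine LinearMap.finrank_le_finrank_of_injective (f := g) (fun v w hvw => ?_)
      have h' : ρ⁻¹ * (v : ℂ) = ρ⁻¹ * (w : ℂ) := congrArg (fun z : W => (z : ℂ)) hvw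
      exact Subtype.ext (mul_left_cancel₀ (inv_ne_zero hρ0) h')
    set c := Module.finrank ℚ ↥(Vj ⊓ V0) with hc
    have hr : (Module.finrank ℚ (Submodule.span ℚ (gridCols x y (insert j {j₀}))) : Cardinal) +
        (c : Cardinal) = (d : Cardinal) + d := by
      rw [hspan]
      exact_mod_cast hfin
    rw [← Cardinal.add_le_add_iff_of_lt_aleph0 (Cardinal.natCast_lt_aleph0 (n := c)), hr]
    calc Algebra.trdeg ℚ ↥(adjoin ℚ (Set.range (gridCol x y j₀))) + ((d - 1 : ℕ) : Cardinal) +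
          (c : Cardinal)
        ≤ Algebra.trdeg ℚ ↥(adjoin ℚ (Set.range (gridCol x y j₀))) + ((d - 1 : ℕ) : Cardinal) +
          (Module.finrank ℚ W : Cardinal) := by gcongr
      _ = (Algebra.trdeg ℚ ↥(adjoin ℚ (Set.range (gridCol x y j₀))) +
          (Module.finrank ℚ W : Cardinal)) + ((d - 1 : ℕ) : Cardinal) := add_right_comm _ _ _
      _ ≤ ((d : Cardinal) + 1) + ((d - 1 : ℕ) : Cardinal) := by gcongr
      _ = ((d + 1 + (d - 1) : ℕ) : Cardinal) := by push_cast; rfl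
      _ = ((d + d : ℕ) : Cardinal) := by congr 1; omega
      _ = (d : Cardinal) + d := by push_cast; rfl

/-- **Filtration, all columns.** If some ratio `yⱼ/y_{j₀}` is transcendental over `ℚ`, then
`trdeg ℚ(all columns) + (d - 1) ≤ dim span(all columns)` (start from the pair `{j₀, j}` and add
the remaining columns one at a time). [folklore] -/
theorem colInvariant_univ (i₀ : Fin d) {j₀ j : Fin l} (hx : LinearIndependent ℚ x)
    (hy : ∀ j, y j ≠ 0) (hρ : Transcendental ℚ (y j / y j₀)) :
    Algebra.trdeg ℚ ↥(adjoin ℚ (gridCols x y Finset.univ)) + ((d - 1 : ℕ) : Cardinal) ≤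
      (Module.finrank ℚ (Submodule.span ℚ (gridCols x y Finset.univ)) : Cardinal) := by
  have key : ∀ T : Finset (Fin l),
      Algebra.trdeg ℚ ↥(adjoin ℚ (gridCols x y (insert j {j₀} ∪ T))) + ((d - 1 : ℕ) : Cardinal) ≤
        (Module.finrank ℚ (Submodule.span ℚ (gridCols x y (insert j {j₀} ∪ T))) : Cardinal) := by
    intro T
    induction T using Finset.induction_on with
    | empty =>
      rw [Finset.union_empty]
      exact colInvariant_pair i₀ hx hy hρ
    | @insert k T hk ih =>
      rw [Finset.union_insert]
      exact colInvariant_insert i₀ hx hy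
        (Finset.mem_union_left _ (Finset.mem_insert_of_mem (Finset.mem_singleton_self _))) k ih
  have hu : insert j {j₀} ∪ (Finset.univ : Finset (Fin l)) = Finset.univ := by
    ext k
    simp
  have h := key Finset.univ
  rwa [hu] at h

/-- **Column theorem.** For `x` `ℚ`-linearly independent, all `yⱼ ≠ 0`, and some ratio
`yⱼ/y_{j₀}` transcendental over `ℚ`: `trdeg_ℚ ℚ(xᵢyⱼ) + (d - 1) ≤ dim_ℚ span_ℚ{xᵢyⱼ}`. [folklore] -/
theorem trdeg_add_le_finrank_of_transcendental_col (i₀ : Fin d) {j₀ j : Fin l}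
    (hx : LinearIndependent ℚ x) (hy : ∀ j, y j ≠ 0) (hρ : Transcendental ℚ (y j / y j₀)) :
    Algebra.trdeg ℚ ↥(adjoin ℚ (Set.range fun p : Fin d × Fin l => x p.1 * y p.2)) +
        ((d - 1 : ℕ) : Cardinal) ≤
      (Module.finrank ℚ
        (Submodule.span ℚ (Set.range fun p : Fin d × Fin l => x p.1 * y p.2)) : Cardinal) := by
  have h := colInvariant_univ i₀ hx hy hρ
  rwa [gridCols_univ] at h

/-- Transposing the grid does not change the set of products. [folklore] -/
theorem range_grid_swap (x : Fin d → ℂ) (y : Fin l → ℂ) :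
    (Set.range fun p : Fin l × Fin d => y p.1 * x p.2) =
      Set.range fun p : Fin d × Fin l => x p.1 * y p.2 := by
  ext z
  constructor
  · rintro ⟨⟨j, i⟩, rfl⟩
    exact ⟨(i, j), mul_comm _ _⟩
  · rintro ⟨⟨i, j⟩, rfl⟩
    exact ⟨(j, i), mul_comm _ _⟩

/-- **Row theorem** (the column theorem for the transposed grid): for `y` `ℚ`-linearly
independent, all `xᵢ ≠ 0`, and some ratio `xᵢ/x_{i₀}` transcendental over `ℚ`:
`trdeg_ℚ ℚ(xᵢyⱼ) + (ℓ - 1) ≤ dim_ℚ span_ℚ{xᵢyⱼ}`. [folklore] -/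
theorem trdeg_add_le_finrank_of_transcendental_row (j₀ : Fin l) {i₀ i : Fin d}
    (hy : LinearIndependent ℚ y) (hx : ∀ i, x i ≠ 0) (hσ : Transcendental ℚ (x i / x i₀)) :
    Algebra.trdeg ℚ ↥(adjoin ℚ (Set.range fun p : Fin d × Fin l => x p.1 * y p.2)) +
        ((l - 1 : ℕ) : Cardinal) ≤
      (Module.finrank ℚ
        (Submodule.span ℚ (Set.range fun p : Fin d × Fin l => x p.1 * y p.2)) : Cardinal) := by
  have h := trdeg_add_le_finrank_of_transcendental_col (x := y) (y := x) j₀ hy hx hσ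
  rwa [range_grid_swap x y] at h

/-- **The algebraic case.** If all ratios `xᵢ/x_{i₀}` and `yⱼ/y_{j₀}` are algebraic over `ℚ`,
then `ℚ(xᵢyⱼ) ⊆ ℚ(x_{i₀}y_{j₀}, ratios)` has transcendence degree `≤ 1`. [folklore] -/
theorem trdeg_adjoin_grid_le_one_of_isAlgebraic {i₀ : Fin d} {j₀ : Fin l} (hx₀ : x i₀ ≠ 0)
    (hy₀ : y j₀ ≠ 0) (hxa : ∀ i, IsAlgebraic ℚ (x i / x i₀))
    (hya : ∀ j, IsAlgebraic ℚ (y j / y j₀)) :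
    Algebra.trdeg ℚ ↥(adjoin ℚ (Set.range fun p : Fin d × Fin l => x p.1 * y p.2)) ≤ 1 := by
  set T : Set ℂ := Set.range (fun i => x i / x i₀) ∪ Set.range (fun j => y j / y j₀) with hT
  have hTalg : ∀ z ∈ T, IsAlgebraic ℚ z := by
    rintro z (⟨i, rfl⟩ | ⟨j, rfl⟩)
    exacts [hxa i, hya j]
  have hle : adjoin ℚ (Set.range fun p : Fin d × Fin l => x p.1 * y p.2) ≤
      adjoin ℚ ({x i₀ * y j₀} ∪ T) := by
    rw [adjoin_le_iff]
    rintro z ⟨⟨i, j⟩, rfl⟩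
    have h1 : x i₀ * y j₀ ∈ adjoin ℚ ({x i₀ * y j₀} ∪ T) := subset_adjoin ℚ _ (Or.inl rfl)
    have h2 : x i / x i₀ ∈ adjoin ℚ ({x i₀ * y j₀} ∪ T) :=
      subset_adjoin ℚ _ (Or.inr (Or.inl ⟨i, rfl⟩))
    have h3 : y j / y j₀ ∈ adjoin ℚ ({x i₀ * y j₀} ∪ T) :=
      subset_adjoin ℚ _ (Or.inr (Or.inr ⟨j, rfl⟩))
    have hid : x i * y j = x i₀ * y j₀ * (x i / x i₀ * (y j / y j₀)) := by
      field_simp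
    show x i * y j ∈ (adjoin ℚ ({x i₀ * y j₀} ∪ T) : Set ℂ)
    rw [hid]
    exact mul_mem h1 (mul_mem h2 h3)
  refine (trdeg_mono hle).trans ?_
  rw [trdeg_adjoin_union_eq_of_isAlgebraic _ _ hTalg]
  refine (trdeg_adjoin_le_mk _).trans ?_
  simp

/-- **Rank-one grid inequality (★).** For `ℚ`-linearly independent `x₁, …, x_d` and
`y₁, …, y_ℓ` (`d, ℓ ≥ 1`):
`trdeg_ℚ ℚ(xᵢyⱼ ; i ≤ d, j ≤ ℓ) + (min(d, ℓ) - 1) ≤ dim_ℚ span_ℚ{xᵢyⱼ}`.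
Cases: some `yⱼ/y_{j₀}` transcendental (column theorem, gives `+ (d-1)`), some `xᵢ/x_{i₀}`
transcendental (row theorem, `+ (ℓ-1)`), or all ratios algebraic (`trdeg ≤ 1 ≤ d - (d-1)` and the
span contains a column, of dimension `d`). The bound is attained (`x` a `ℚ`-basis of `θF`, `y` a
`ℚ`-basis of `F`, `F` a number field of degree `n = d = ℓ`, `θ` transcendental: dimension `n`,
transcendence degree `1`). [folklore] -/
theorem trdeg_add_min_sub_one_le_finrank_grid (hx : LinearIndependent ℚ x)
    (hy : LinearIndependent ℚ y) (i₀ : Fin d) (j₀ : Fin l) :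
    Algebra.trdeg ℚ ↥(adjoin ℚ (Set.range fun p : Fin d × Fin l => x p.1 * y p.2)) +
        ((min d l - 1 : ℕ) : Cardinal) ≤
      (Module.finrank ℚ
        (Submodule.span ℚ (Set.range fun p : Fin d × Fin l => x p.1 * y p.2)) : Cardinal) := by
  have hx0 : ∀ i, x i ≠ 0 := fun i => hx.ne_zero i
  have hy0 : ∀ j, y j ≠ 0 := fun j => hy.ne_zero j
  have hd : 1 ≤ d := i₀.pos
  by_cases hcol : ∃ j, Transcendental ℚ (y j / y j₀)
  · obtain ⟨j, hj⟩ := hcol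
    have h := trdeg_add_le_finrank_of_transcendental_col i₀ hx hy0 hj
    have hmin : ((min d l - 1 : ℕ) : Cardinal) ≤ ((d - 1 : ℕ) : Cardinal) := by
      exact_mod_cast (by omega : min d l - 1 ≤ d - 1)
    refine le_trans ?_ h
    gcongr
  by_cases hrow : ∃ i, Transcendental ℚ (x i / x i₀)
  · obtain ⟨i, hi⟩ := hrow
    have h := trdeg_add_le_finrank_of_transcendental_row j₀ hy hx0 hi
    have hmin : ((min d l - 1 : ℕ) : Cardinal) ≤ ((l - 1 : ℕ) : Cardinal) := by
      exact_mod_cast (by omega : min d l - 1 ≤ l - 1)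
    refine le_trans ?_ h
    gcongr
  have hya : ∀ j, IsAlgebraic ℚ (y j / y j₀) := fun j => by
    by_contra h
    exact hcol ⟨j, h⟩
  have hxa : ∀ i, IsAlgebraic ℚ (x i / x i₀) := fun i => by
    by_contra h
    exact hrow ⟨i, h⟩
  have h1 := trdeg_adjoin_grid_le_one_of_isAlgebraic (hx0 i₀) (hy0 j₀) hxa hya
  haveI : FiniteDimensional ℚ
      (Submodule.span ℚ (Set.range fun p : Fin d × Fin l => x p.1 * y p.2)) :=
    FiniteDimensional.span_of_finite ℚ (Set.finite_range _)
  have hr : d ≤ Module.finrank ℚ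
      (Submodule.span ℚ (Set.range fun p : Fin d × Fin l => x p.1 * y p.2)) := by
    have hsub : Set.range (gridCol x y j₀) ⊆ Set.range fun p : Fin d × Fin l => x p.1 * y p.2 := by
      rintro z ⟨i, rfl⟩
      exact ⟨(i, j₀), rfl⟩
    have h := Submodule.finrank_mono (Submodule.span_mono (R := ℚ) hsub)
    rwa [finrank_span_gridCol hx (hy0 j₀)] at h
  have hmin : ((min d l - 1 : ℕ) : Cardinal) ≤ ((d - 1 : ℕ) : Cardinal) := by
    exact_mod_cast (by omega : min d l - 1 ≤ d - 1)
  calc Algebra.trdeg ℚ ↥(adjoin ℚ (Set.range fun p : Fin d × Fin l => x p.1 * y p.2)) +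
        ((min d l - 1 : ℕ) : Cardinal)
      ≤ 1 + ((d - 1 : ℕ) : Cardinal) := by gcongr
    _ = ((1 + (d - 1) : ℕ) : Cardinal) := by push_cast; rfl
    _ = (d : Cardinal) := by congr 1; omega
    _ ≤ _ := by exact_mod_cast hr

end Grid

/-! ### With Schanuel's conjecture: `trdeg ℚ(e^{xᵢyⱼ}) ≥ min(d, ℓ) - 1` -/

section Schanuel

variable {d l : ℕ}

/-- **Schanuel step.** `dim_ℚ span{xᵢyⱼ} ≤ trdeg ℚ(e^{xᵢyⱼ}) + trdeg ℚ(xᵢyⱼ)` under Schanuel's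
conjecture: choose a `ℚ`-basis `B ⊆ {xᵢyⱼ}` of the span; Schanuel gives `|B| ≤ trdeg ℚ(B, e^B)`,
and `ℚ(B, e^B) ⊆ ℚ(e^{xy} ∪ B)` has transcendence degree `≤ trdeg ℚ(e^{xy}) + trdeg ℚ(B)`
(`trdeg_adjoin_union_le`), with `ℚ(B) = ℚ(xᵢyⱼ)`. [folklore] -/
theorem finrank_span_grid_le_trdeg_exp_add (hSC : ∀ n, SchanuelRank n) (x : Fin d → ℂ)
    (y : Fin l → ℂ) :
    (Module.finrank ℚ
        (Submodule.span ℚ (Set.range fun p : Fin d × Fin l => x p.1 * y p.2)) : Cardinal) ≤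
      Algebra.trdeg ℚ ↥(adjoin ℚ (Set.range fun p : Fin d × Fin l => cexp (x p.1 * y p.2))) +
        Algebra.trdeg ℚ ↥(adjoin ℚ (Set.range fun p : Fin d × Fin l => x p.1 * y p.2)) := by
  set S : Set ℂ := Set.range fun p : Fin d × Fin l => x p.1 * y p.2 with hS
  set U : Set ℂ := Set.range fun p : Fin d × Fin l => cexp (x p.1 * y p.2) with hU
  obtain ⟨B, hBS, hBspan, hBli⟩ := exists_linearIndependent ℚ S
  have hBfin : B.Finite := (Set.finite_range _).subset hBS
  haveI : Fintype B := hBfin.fintype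
  set n := Fintype.card B with hn
  have hr : Module.finrank ℚ (Submodule.span ℚ S) = n := by
    rw [← hBspan, finrank_span_set_eq_card (R := ℚ) hBli, hn, Set.toFinset_card]
  set e := (Fintype.equivFin B).symm with he
  set b : Fin n → ℂ := fun i => ((e i : B) : ℂ) with hb
  have hbli : LinearIndependent ℚ b := hBli.comp _ e.injective
  have hS' := hSC n b hbli
  have hle : adjoin ℚ (Set.range b ∪ Set.range (cexp ∘ b)) ≤ adjoin ℚ (U ∪ B) := by
    rw [adjoin_le_iff]
    rintro z (⟨i, rfl⟩ | ⟨i, rfl⟩)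
    · exact subset_adjoin ℚ _ (Or.inr (e i).2)
    · have hmem : ((e i : B) : ℂ) ∈ S := hBS (e i).2
      obtain ⟨p, hp⟩ := hmem
      have hp' : x p.1 * y p.2 = b i := hp
      refine subset_adjoin ℚ _ (Or.inl ⟨p, ?_⟩)
      show cexp (x p.1 * y p.2) = cexp (b i)
      rw [hp']
  have h1 : (n : Cardinal) ≤ Algebra.trdeg ℚ ↥(adjoin ℚ (U ∪ B)) :=
    hS'.trans (trdeg_mono hle)
  have h2 := trdeg_adjoin_union_le (K := ℚ) U B
  have hBadj : adjoin ℚ B = adjoin ℚ S := by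
    refine le_antisymm (adjoin.mono ℚ _ _ hBS) (adjoin_le_iff.mpr fun z hz => ?_)
    have hz' : z ∈ Submodule.span ℚ B := by
      rw [hBspan]
      exact Submodule.subset_span hz
    exact span_le_adjoin _ hz'
  rw [hr]
  calc (n : Cardinal) ≤ _ := h1
    _ ≤ _ := h2
    _ = Algebra.trdeg ℚ ↥(adjoin ℚ U) + Algebra.trdeg ℚ ↥(adjoin ℚ S) := by
        rw [hBadj]
        rfl

/-- **Schanuel ⟹ `trdeg_ℚ ℚ(e^{xᵢyⱼ}) ≥ min(d, ℓ) - 1`** for `ℚ`-linearly independent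
`x₁, …, x_d` and `y₁, …, y_ℓ` (`d, ℓ ≥ 1`): the Schanuel step `dim span ≤ t + trdeg ℚ(xᵢyⱼ)`
against the rank-one grid inequality `trdeg ℚ(xᵢyⱼ) + min(d,ℓ) - 1 ≤ dim span`
(`trdeg_add_min_sub_one_le_finrank_grid`), cancelling the finite `trdeg ℚ(xᵢyⱼ)`. This is the
`t`-clause of Waldschmidt's Conjecture 2.3 (LNM 1752, Ch. 14) from Schanuel's conjecture, since
`[dℓ/(ℓ+d)] ≤ min(d, ℓ) - 1`. [folklore] -/
theorem min_sub_one_le_trdeg_exp_grid_of_schanuel (hSC : ∀ n, SchanuelRank n) {x : Fin d → ℂ}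
    {y : Fin l → ℂ} (hx : LinearIndependent ℚ x) (hy : LinearIndependent ℚ y) (hd : 1 ≤ d)
    (hl : 1 ≤ l) :
    ((min d l - 1 : ℕ) : Cardinal) ≤
      Algebra.trdeg ℚ ↥(adjoin ℚ (Set.range fun p : Fin d × Fin l => cexp (x p.1 * y p.2))) := by
  set S : Set ℂ := Set.range fun p : Fin d × Fin l => x p.1 * y p.2 with hS
  have hA := finrank_span_grid_le_trdeg_exp_add hSC x y
  have hB := trdeg_add_min_sub_one_le_finrank_grid hx hy ⟨0, hd⟩ ⟨0, hl⟩
  have ha : Algebra.trdeg ℚ ↥(adjoin ℚ S) < ℵ₀ :=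
    lt_of_le_of_lt (trdeg_adjoin_le_mk S) (Set.finite_range _).lt_aleph0
  have h : ((min d l - 1 : ℕ) : Cardinal) + Algebra.trdeg ℚ ↥(adjoin ℚ S) ≤
      Algebra.trdeg ℚ ↥(adjoin ℚ (Set.range fun p : Fin d × Fin l => cexp (x p.1 * y p.2))) +
        Algebra.trdeg ℚ ↥(adjoin ℚ S) := by
    rw [add_comm]
    exact hB.trans hA
  exact (Cardinal.add_le_add_iff_of_lt_aleph0 ha).mp h

end Schanuel

end Literature.NumberTheory.Transcendental

end
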